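import Mathlib.RingTheory.DedekindDomain.AdicValuation
import Mathlib.RingTheory.DiscreteValuationRing.TFAE
import Mathlib.FieldTheory.IntermediateField.Adjoin.Basic
import Mathlib.Algebra.Polynomial.EraseLead
import Literature.NumberTheory.DiophantineGeometry.WeierstrassPlaceAtInfinity
import Literature.NumberTheory.EllipticCurves.CoordinateRingRegular
import Literature.NumberTheory.DiophantineGeometry.FunctionFieldGenus
import Literature.NumberTheory.DiophantineGeometry.FunctionFieldGenusProofs
import Literature.NumberTheory.DiophantineGeometry.FunctionFieldGenusRatPlacesProofs
import HarnessLib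

/-!
# The places of the function field of a smooth Weierstrass curve

Let `K` be a field, `W/K` an affine Weierstrass curve with coordinate ring `K[W]` and function
field `K(W) = Frac K[W]` (Mathlib `WeierstrassCurve.Affine.CoordinateRing`, `.FunctionField`).
This file classifies the places of `K(W)/K` (in the sense of
`Literature.NumberTheory.DiophantineGeometry.FunctionFieldDivisors`: valuation rings
`K ⊆ O ⊊ K(W)` which are DVRs) when `K[W]` is a Dedekind domain — e.g. `Δ ≠ 0`, in particular
`[W.IsElliptic]`, by `Literature.NumberTheory.EllipticCurves.CoordinateRingRegular` — and proves
that `K(W)/K` is an algebraic function field of one variable with full constant field `K`.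

## Main results (namespace `Literature.WeierstrassPlaces`)

* Valuation lemmas for a valuation `w` of `K(W)` with `w ≤ 1` on `K` (`section Valuations`):
  `map_polynomial_eq` (`w x > 1 ⇒ w(h(x)) = (w x)^{deg h}`), `map_y_le_one`
  (`w x ≤ 1 ⇒ w y ≤ 1`, i.e. `K[W] ⊆ O_w`), `map_y_sq` (`w x > 1 ⇒ (w y)² = (w x)³`) and
  `map_le_one_of_infValuationF_le_one` (`w x > 1 ⇒ O_∞ ⊆ O_w`).
* `isAlgFunctionField : IsAlgFunctionField K K(W)` (`trdeg = 1`, `K(W) = K(x, y)`), for every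
  Weierstrass equation; hence (`FunctionFieldGenusProofs`) every place has finite degree.
* `eq_infPlace`: a place not containing `x` is the place at infinity `P_∞` of
  `WeierstrassPlaceAtInfinity` (any Weierstrass equation).
* For `[IsDedekindDomain K[W]]`, with the finite places `PlaceOver.ofPrime K K(W) 𝔭` of the
  maximal ideals `𝔭 ⊂ K[W]` (`FunctionFieldGenusRatPlacesProofs`; valuation ring `K[W]_𝔭`):
  `infPlace_ne_ofPrime`, `exists_eq_ofPrime` (a place containing `x` is finite), the
  classification `eq_infPlace_or_exists_eq_ofPrime` and the bijection
  `placeEquiv : Option (MaxSpec K[W]) ≃ PlaceOver K K(W)`;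
  `exists_eq_algebraMap_of_forall_mem` (`⋂_P O_P = K`, i.e. `L(0) = K`) and the instance
  `isIntegrallyClosedIn : IsIntegrallyClosedIn K K(W)` (`K` is the full constant field).

This is the place-theoretic content of Silverman, *AEC*, Ch. II §§1–2 (points of a smooth curve
↔ discrete valuations of its function field, Prop. II.1.1; a function without poles is constant,
Prop. II.1.2) specialised to Weierstrass cubics (Prop. III.3.1: the only point at infinity is
`O = [0,1,0]`), and is used in the proof of `AlgFunctionField.genus_functionField_weierstrass`.
Over a non-perfect `K` we work with closed points (maximal ideals) instead of `K̄`-points, which is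
why the hypothesis is `IsDedekindDomain K[W]` (all local rings at closed points are DVRs).

## Proof sketch of the classification

Let `P` be a place with valuation `w`. If `w x ≤ 1` then `w y ≤ 1` by the Weierstrass equation
(`y` is integral over `K[x]`), so `K[W] ⊆ O_P`; the centre `𝔭 = {r : w r < 1}` is a nonzero prime
(if it were `0`, every element `r/s` of `K(W)` would have `w ≤ 1`), `K[W]_𝔭 ⊆ O_P`, and a DVR is
a maximal proper subring (Mathlib `ValuationSubring.eq_of_le_of_ne_top`). If `w x > 1` then
`w y > w x` and `(w y)² = (w x)³` (compare both sides of the equation), which forces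
`w((a(x) + b(x)y)/d(x)) ≤ 1` whenever `2 deg a ≤ 2 deg d` and `2 deg b + 3 ≤ 2 deg d`, i.e.
`O_∞ ⊆ O_P`, and again equality.

## References

* J. H. Silverman, *The Arithmetic of Elliptic Curves*, 2nd ed., GTM 106, Springer 2009,
  Prop. II.1.1, Prop. II.1.2, §II.2, Prop. III.3.1.
* H. Stichtenoth, *Algebraic Function Fields and Codes*, GTM 254, Springer 2009, Def. 1.1.1,
  Thm. 1.1.6, Prop. 1.1.15, Cor. 1.1.20, Prop. 6.1.3.
-/

noncomputable section

open Polynomial WithZero IsDedekindDomain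
open scoped Polynomial.Bivariate

namespace Literature.NumberTheory.DiophantineGeometry.WeierstrassPlaces

universe u

variable {K : Type u} [Field K] (W : WeierstrassCurve.Affine K)

/-! ### Valuations of `K(W)` trivial on `K` -/

section Valuations

variable {Γ : Type*} [LinearOrderedCommGroupWithZero Γ] (w : Valuation W.FunctionField Γ)

/-- A valuation `≤ 1` on `K` is `= 1` on `Kˣ`. [folklore] -/
theorem map_algebraMap_eq_one (hK : ∀ c : K, w (algebraMap K W.FunctionField c) ≤ 1) {c : K}
    (hc : c ≠ 0) : w (algebraMap K W.FunctionField c) = 1 := by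
  refine le_antisymm (hK c) ?_
  have h1 : w (algebraMap K W.FunctionField c) * w (algebraMap K W.FunctionField c⁻¹) = 1 := by
    rw [← map_mul, ← map_mul, mul_inv_cancel₀ hc, map_one, map_one]
  by_contra hlt
  rw [not_le] at hlt
  have := mul_lt_one_of_lt_of_le hlt (hK c⁻¹)
  exact this.ne h1

/-- `h(x) ∈ K(W)` is the evaluation of `h` at `x`. [folklore] -/
theorem algebraMap_polynomial_eq_aeval (h : K[X]) :
    algebraMap K[X] W.FunctionField h = aeval (algebraMap K[X] W.FunctionField X) h := by
  have := aeval_algHom_apply (IsScalarTower.toAlgHom K K[X] W.FunctionField) X h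
  rw [aeval_X_left_apply] at this
  exact this.symm

/-- If `w ≤ 1` on `K` then `w(h(x)) ≤ max 1 (w x) ^ deg h`. [folklore] -/
theorem map_polynomial_le (hK : ∀ c : K, w (algebraMap K W.FunctionField c) ≤ 1) (h : K[X]) :
    w (algebraMap K[X] W.FunctionField h) ≤
      max 1 (w (algebraMap K[X] W.FunctionField X)) ^ h.natDegree := by
  rw [algebraMap_polynomial_eq_aeval, aeval_eq_sum_range]
  refine Valuation.map_sum_le _ fun i hi ↦ ?_
  rw [Finset.mem_range] at hi
  rw [Algebra.smul_def, map_mul, map_pow]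
  calc w (algebraMap K W.FunctionField (h.coeff i)) * w (algebraMap K[X] W.FunctionField X) ^ i
      ≤ 1 * max 1 (w (algebraMap K[X] W.FunctionField X)) ^ i :=
        mul_le_mul' (hK _) (pow_le_pow_left₀ zero_le (le_max_right _ _) i)
    _ ≤ max 1 (w (algebraMap K[X] W.FunctionField X)) ^ h.natDegree := by
        rw [one_mul]
        exact pow_le_pow_right₀ (le_max_left _ _) (by omega)

/-- If `w ≤ 1` on `K` and `w x ≤ 1` then `w(h(x)) ≤ 1` for every polynomial `h`. [folklore] -/
theorem map_polynomial_le_one (hK : ∀ c : K, w (algebraMap K W.FunctionField c) ≤ 1)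
    (hx : w (algebraMap K[X] W.FunctionField X) ≤ 1) (h : K[X]) :
    w (algebraMap K[X] W.FunctionField h) ≤ 1 := by
  refine (map_polynomial_le W w hK h).trans ?_
  rw [max_eq_left hx, one_pow]

/-- `w(c · x ^ n) = (w x) ^ n` for a nonzero constant `c`, if `w ≤ 1` on `K`. [folklore] -/
theorem map_C_mul_X_pow (hK : ∀ c : K, w (algebraMap K W.FunctionField c) ≤ 1) {c : K}
    (hc : c ≠ 0) (n : ℕ) :
    w (algebraMap K[X] W.FunctionField (C c * X ^ n)) =
      w (algebraMap K[X] W.FunctionField X) ^ n := by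
  rw [map_mul, map_pow, map_mul, map_pow, show C c = algebraMap K K[X] c from rfl,
    ← IsScalarTower.algebraMap_apply, map_algebraMap_eq_one W w hK hc, one_mul]

/-- If `w ≤ 1` on `K` and `w x > 1` then `w(h(x)) = (w x) ^ deg h` for `h ≠ 0`: the leading term
dominates. [folklore] -/
theorem map_polynomial_eq (hK : ∀ c : K, w (algebraMap K W.FunctionField c) ≤ 1)
    (hx : 1 < w (algebraMap K[X] W.FunctionField X)) {h : K[X]} (hh : h ≠ 0) :
    w (algebraMap K[X] W.FunctionField h) = w (algebraMap K[X] W.FunctionField X) ^ h.natDegree := by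
  induction hn : h.natDegree using Nat.strong_induction_on generalizing h with
  | _ n ih =>
    have hlead := map_C_mul_X_pow W w hK (leadingCoeff_ne_zero.2 hh) h.natDegree
    have hdecomp : h = h.eraseLead + C h.leadingCoeff * X ^ h.natDegree :=
      (eraseLead_add_C_mul_X_pow h).symm
    by_cases h0 : h.eraseLead = 0
    · conv_lhs => rw [hdecomp, h0, zero_add]
      rw [hlead, hn]
    · have hlt : h.eraseLead.natDegree < h.natDegree :=
        (eraseLead_natDegree_lt_or_eraseLead_eq_zero h).resolve_right h0
      have hlt' : w (algebraMap K[X] W.FunctionField h.eraseLead) <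
          w (algebraMap K[X] W.FunctionField (C h.leadingCoeff * X ^ h.natDegree)) := by
        rw [ih _ (hn ▸ hlt) h0 rfl, hlead]
        exact pow_lt_pow_right₀ hx hlt
      conv_lhs => rw [hdecomp]
      rw [map_add, Valuation.map_add_eq_of_lt_right _ hlt', hlead, hn]

/-! ### The Weierstrass equation under a valuation -/

/-- The Weierstrass equation in `K(W)`: `y² + (a₁x + a₃)y = x³ + a₂x² + a₄x + a₆`. [folklore] -/
theorem equation :
    algebraMap W.CoordinateRing W.FunctionField (WeierstrassCurve.Affine.CoordinateRing.mk W Y) ^ 2 +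
      algebraMap K[X] W.FunctionField (C W.a₁ * X + C W.a₃) *
        algebraMap W.CoordinateRing W.FunctionField (WeierstrassCurve.Affine.CoordinateRing.mk W Y) =
      algebraMap K[X] W.FunctionField (X ^ 3 + C W.a₂ * X ^ 2 + C W.a₄ * X + C W.a₆) := by
  have h0 : WeierstrassCurve.Affine.CoordinateRing.mk W (Y ^ 2 + C (C W.a₁ * X + C W.a₃) * Y) =
      WeierstrassCurve.Affine.CoordinateRing.mk W (C (X ^ 3 + C W.a₂ * X ^ 2 + C W.a₄ * X + C W.a₆)) :=
    AdjoinRoot.mk_eq_mk.mpr ⟨1, by rw [WeierstrassCurve.Affine.polynomial]; ring1⟩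
  rw [map_add, map_mul, map_pow] at h0
  have h1 := congrArg (algebraMap W.CoordinateRing W.FunctionField) h0
  rw [map_add, map_mul, map_pow] at h1
  rw [IsScalarTower.algebraMap_apply K[X] W.CoordinateRing W.FunctionField,
    IsScalarTower.algebraMap_apply K[X] W.CoordinateRing W.FunctionField (X ^ 3 + _ + _ + _)]
  exact h1

/-- The cubic `x³ + a₂x² + a₄x + a₆` has degree `3`. [folklore] -/
theorem natDegree_cubic : (X ^ 3 + C W.a₂ * X ^ 2 + C W.a₄ * X + C W.a₆ : K[X]).natDegree = 3 := by
  rw [← one_mul (X ^ 3 : K[X]), ← C_1]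
  exact Polynomial.natDegree_cubic one_ne_zero

/-- The cubic `x³ + a₂x² + a₄x + a₆` is nonzero. [folklore] -/
theorem cubic_ne_zero : (X ^ 3 + C W.a₂ * X ^ 2 + C W.a₄ * X + C W.a₆ : K[X]) ≠ 0 := by
  intro h
  have := natDegree_cubic W
  rw [h, natDegree_zero] at this
  exact absurd this (by decide)

/-- The linear form `a₁x + a₃` has degree `≤ 1`. [folklore] -/
theorem natDegree_lin_le : (C W.a₁ * X + C W.a₃ : K[X]).natDegree ≤ 1 :=
  natDegree_linear_le

/-- If `w ≤ 1` on `K` and `w x ≤ 1` then `w y ≤ 1` (`y` is integral over `K[x]`). [folklore] -/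
theorem map_y_le_one (hK : ∀ c : K, w (algebraMap K W.FunctionField c) ≤ 1)
    (hx : w (algebraMap K[X] W.FunctionField X) ≤ 1) :
    w (algebraMap W.CoordinateRing W.FunctionField (WeierstrassCurve.Affine.CoordinateRing.mk W Y))
      ≤ 1 := by
  by_contra hy
  rw [not_le] at hy
  set y := algebraMap W.CoordinateRing W.FunctionField (WeierstrassCurve.Affine.CoordinateRing.mk W Y)
  have heq := equation W
  have hlin : w (algebraMap K[X] W.FunctionField (C W.a₁ * X + C W.a₃) * y) < w (y ^ 2) := by
    rw [map_mul, map_pow, sq]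
    exact mul_lt_mul_of_pos_right ((map_polynomial_le_one W w hK hx _).trans_lt hy)
      (zero_lt_one.trans hy)
  have hlhs : w (y ^ 2 + algebraMap K[X] W.FunctionField (C W.a₁ * X + C W.a₃) * y) = w y ^ 2 := by
    rw [Valuation.map_add_eq_of_lt_left _ hlin, map_pow]
  have hrhs : w (algebraMap K[X] W.FunctionField (X ^ 3 + C W.a₂ * X ^ 2 + C W.a₄ * X + C W.a₆))
      ≤ 1 := map_polynomial_le_one W w hK hx _
  rw [← heq, hlhs] at hrhs
  have : (1 : Γ) < w y ^ 2 := one_lt_pow₀ hy two_ne_zero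
  exact absurd hrhs (not_le.2 this)

/-- If `w ≤ 1` on `K` and `w x ≤ 1` then `w ≤ 1` on all of `K[W]`. [folklore] -/
theorem map_coordinateRing_le_one (hK : ∀ c : K, w (algebraMap K W.FunctionField c) ≤ 1)
    (hx : w (algebraMap K[X] W.FunctionField X) ≤ 1) (r : W.CoordinateRing) :
    w (algebraMap W.CoordinateRing W.FunctionField r) ≤ 1 := by
  obtain ⟨p, q, rfl⟩ := WeierstrassCurve.Affine.CoordinateRing.exists_smul_basis_eq r
  rw [map_add, Algebra.smul_def, mul_one, Algebra.smul_def, map_mul,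
    ← IsScalarTower.algebraMap_apply, ← IsScalarTower.algebraMap_apply]
  refine Valuation.map_add_le _ (map_polynomial_le_one W w hK hx p) ?_
  rw [map_mul]
  exact mul_le_one' (map_polynomial_le_one W w hK hx q) (map_y_le_one W w hK hx)

/-- If `w ≤ 1` on `K` and `w x > 1` then `w x < w y` (compare the two sides of the Weierstrass
equation: otherwise the left side has value `≤ (w x)²` and the right side `(w x)³`). [folklore] -/
theorem map_x_lt_map_y (hK : ∀ c : K, w (algebraMap K W.FunctionField c) ≤ 1)
    (hx : 1 < w (algebraMap K[X] W.FunctionField X)) :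
    w (algebraMap K[X] W.FunctionField X) <
      w (algebraMap W.CoordinateRing W.FunctionField (WeierstrassCurve.Affine.CoordinateRing.mk W Y)) := by
  by_contra hy
  rw [not_lt] at hy
  set y := algebraMap W.CoordinateRing W.FunctionField (WeierstrassCurve.Affine.CoordinateRing.mk W Y)
  set x := algebraMap K[X] W.FunctionField X
  have heq := equation W
  have hrhs : w (algebraMap K[X] W.FunctionField (X ^ 3 + C W.a₂ * X ^ 2 + C W.a₄ * X + C W.a₆))
      = w x ^ 3 := by
    rw [map_polynomial_eq W w hK hx (cubic_ne_zero W), natDegree_cubic]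
  have hlinp : w (algebraMap K[X] W.FunctionField (C W.a₁ * X + C W.a₃)) ≤ w x := by
    refine (map_polynomial_le W w hK _).trans ?_
    rw [max_eq_right hx.le]
    exact (pow_le_pow_right₀ hx.le (natDegree_lin_le W)).trans (pow_one _).le
  have hlhs : w (y ^ 2 + algebraMap K[X] W.FunctionField (C W.a₁ * X + C W.a₃) * y) ≤ w x ^ 2 := by
    refine Valuation.map_add_le _ ?_ ?_
    · rw [map_pow]
      exact pow_le_pow_left₀ zero_le hy 2
    · rw [map_mul, sq]
      exact mul_le_mul' hlinp hy
  rw [heq, hrhs] at hlhs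
  exact absurd hlhs (not_le.2 (pow_lt_pow_right₀ hx (by norm_num)))

/-- If `w ≤ 1` on `K` and `w x > 1` then `(w y)² = (w x)³` (`2 ord y = 3 ord x` at a pole of `x`).
[folklore] -/
theorem map_y_sq (hK : ∀ c : K, w (algebraMap K W.FunctionField c) ≤ 1)
    (hx : 1 < w (algebraMap K[X] W.FunctionField X)) :
    w (algebraMap W.CoordinateRing W.FunctionField (WeierstrassCurve.Affine.CoordinateRing.mk W Y)) ^ 2
      = w (algebraMap K[X] W.FunctionField X) ^ 3 := by
  set y := algebraMap W.CoordinateRing W.FunctionField (WeierstrassCurve.Affine.CoordinateRing.mk W Y)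
  set x := algebraMap K[X] W.FunctionField X
  have hxy := map_x_lt_map_y W w hK hx
  have heq := equation W
  have hlinp : w (algebraMap K[X] W.FunctionField (C W.a₁ * X + C W.a₃)) ≤ w x := by
    refine (map_polynomial_le W w hK _).trans ?_
    rw [max_eq_right hx.le]
    exact (pow_le_pow_right₀ hx.le (natDegree_lin_le W)).trans (pow_one _).le
  have hlin : w (algebraMap K[X] W.FunctionField (C W.a₁ * X + C W.a₃) * y) < w (y ^ 2) := by
    rw [map_mul, map_pow, sq]
    exact mul_lt_mul_of_pos_right (hlinp.trans_lt hxy) (zero_lt_one.trans (hx.trans hxy))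
  have hlhs : w (y ^ 2 + algebraMap K[X] W.FunctionField (C W.a₁ * X + C W.a₃) * y) = w y ^ 2 := by
    rw [Valuation.map_add_eq_of_lt_left _ hlin, map_pow]
  rw [← hlhs, heq, map_polynomial_eq W w hK hx (cubic_ne_zero W), natDegree_cubic]

/-- **The valuation ring at a pole of `x` contains `O_∞`.** If `w ≤ 1` on `K` and `w x > 1`, then
every `z` with `|z|_∞ ≤ 1` has `w z ≤ 1`: writing `z = (a(x) + b(x)y)/d(x)` with
`2 deg a ≤ 2 deg d` and `2 deg b + 3 ≤ 2 deg d`, one has `w(a(x)) = (w x)^{deg a} ≤ (w x)^{deg d}` and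
`(w(b(x)y))² = (w x)^{2 deg b + 3} ≤ (w x)^{2 deg d}`. [folklore] -/
theorem map_le_one_of_infValuationF_le_one (hK : ∀ c : K, w (algebraMap K W.FunctionField c) ≤ 1)
    (hx : 1 < w (algebraMap K[X] W.FunctionField X)) {z : W.FunctionField}
    (hz : WeierstrassPlaceAtInfinity.infValuationF W z ≤ 1) : w z ≤ 1 := by
  obtain ⟨a, b, d, hd, rfl⟩ := WeierstrassPlaceAtInfinity.exists_eq_smul_basis_div W z
  set y := algebraMap W.CoordinateRing W.FunctionField (WeierstrassCurve.Affine.CoordinateRing.mk W Y)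
  set x := algebraMap K[X] W.FunctionField X
  have hdF : algebraMap K[X] W.FunctionField d ≠ 0 :=
    (map_ne_zero_iff _ (FaithfulSMul.algebraMap_injective K[X] W.FunctionField)).2 hd
  have hvd : WeierstrassPlaceAtInfinity.infValuationF W (algebraMap K[X] W.FunctionField d) =
      exp ((2 * d.natDegree : ℕ) : ℤ) :=
    WeierstrassPlaceAtInfinity.infValuationF_algebraMap_polynomial W hd
  have hvd0 : WeierstrassPlaceAtInfinity.infValuationF W (algebraMap K[X] W.FunctionField d) ≠ 0 := by
    rw [hvd]; exact exp_ne_zero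
  rw [map_div₀, div_le_one₀ (zero_lt_iff.2 hvd0), hvd,
    WeierstrassPlaceAtInfinity.infValuationF_algebraMap,
    WeierstrassPlaceAtInfinity.infValuation_smul_basis_le_exp_iff] at hz
  obtain ⟨ha, hb⟩ := hz
  have hwd : w (algebraMap K[X] W.FunctionField d) = w x ^ d.natDegree :=
    map_polynomial_eq W w hK hx hd
  have hwd0 : 0 < w (algebraMap K[X] W.FunctionField d) := by
    rw [hwd]; exact pow_pos (zero_lt_one.trans hx) _
  rw [map_div₀, div_le_one₀ hwd0, hwd, map_add, Algebra.smul_def, mul_one, Algebra.smul_def,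
    map_mul, ← IsScalarTower.algebraMap_apply, ← IsScalarTower.algebraMap_apply]
  refine Valuation.map_add_le _ ?_ ?_
  · rcases eq_or_ne a 0 with rfl | ha0
    · simp
    · have ha' : 2 * a.natDegree ≤ 2 * d.natDegree := ha.resolve_left ha0
      rw [map_polynomial_eq W w hK hx ha0]
      exact pow_le_pow_right₀ hx.le (by omega)
  · rcases eq_or_ne b 0 with rfl | hb0
    · simp
    · have hb' : 2 * b.natDegree + 3 ≤ 2 * d.natDegree := hb.resolve_left hb0
      refine le_of_pow_le_pow_left₀ two_ne_zero zero_le ?_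
      rw [map_mul, mul_pow, map_y_sq W w hK hx, map_polynomial_eq W w hK hx hb0, ← pow_mul,
        ← pow_add, ← pow_mul]
      exact pow_le_pow_right₀ hx.le (by omega)

end Valuations

/-! ### `K(W)/K` is an algebraic function field of one variable -/

/-- Every element of `K[W]` maps into the subfield `K(x, y)` of `K(W)`. [folklore] -/
theorem algebraMap_mem_adjoin (r : W.CoordinateRing) :
    algebraMap W.CoordinateRing W.FunctionField r ∈
      IntermediateField.adjoin K {algebraMap K[X] W.FunctionField X,
        algebraMap W.CoordinateRing W.FunctionField (WeierstrassCurve.Affine.CoordinateRing.mk W Y)} := by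
  set x := algebraMap K[X] W.FunctionField X
  set y := algebraMap W.CoordinateRing W.FunctionField (WeierstrassCurve.Affine.CoordinateRing.mk W Y)
  have hpoly : ∀ p : K[X], algebraMap K[X] W.FunctionField p ∈ IntermediateField.adjoin K {x, y} := by
    intro p
    rw [algebraMap_polynomial_eq_aeval]
    refine IntermediateField.algebra_adjoin_le_adjoin K _ ?_
    exact Algebra.adjoin_mono (Set.singleton_subset_iff.2 (Set.mem_insert _ _))
      (aeval_mem_adjoin_singleton K x)
  obtain ⟨p, q, rfl⟩ := WeierstrassCurve.Affine.CoordinateRing.exists_smul_basis_eq r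
  rw [map_add, Algebra.smul_def, mul_one, Algebra.smul_def, map_mul,
    ← IsScalarTower.algebraMap_apply, ← IsScalarTower.algebraMap_apply]
  refine add_mem (hpoly p) (mul_mem (hpoly q) ?_)
  exact IntermediateField.subset_adjoin K _ (Set.mem_insert_of_mem _ rfl)

/-- `K(W) = K(x, y)` as a field extension of `K`. [folklore] -/
theorem adjoin_x_y_eq_top :
    IntermediateField.adjoin K {algebraMap K[X] W.FunctionField X,
        algebraMap W.CoordinateRing W.FunctionField (WeierstrassCurve.Affine.CoordinateRing.mk W Y)}
      = ⊤ := by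
  rw [eq_top_iff]
  intro z _
  obtain ⟨r, s, -, rfl⟩ := IsFractionRing.div_surjective (A := W.CoordinateRing) z
  exact div_mem (algebraMap_mem_adjoin W r) (algebraMap_mem_adjoin W s)

/-- `K(W)` is algebraic over `K[X]` (it is the fraction field of the finite `K[X]`-algebra `K[W]`).
[folklore] -/
theorem isAlgebraic_polynomial : Algebra.IsAlgebraic K[X] W.FunctionField := by
  haveI : Algebra.IsIntegral K[X] W.CoordinateRing := Algebra.IsIntegral.of_finite _ _
  haveI : Algebra.IsAlgebraic W.CoordinateRing W.FunctionField :=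
    IsLocalization.isAlgebraic _ (nonZeroDivisors W.CoordinateRing)
  exact Algebra.IsIntegral.trans_isAlgebraic K[X] W.CoordinateRing W.FunctionField

/-- **`K(W)/K` is an algebraic function field of one variable** (Stichtenoth Def. 1.1.1;
Silverman AEC II.2, `K(C)` for a curve `C/K`): `trdeg_K K(W) = trdeg_K K[X] + trdeg_{K[X]} K(W) = 1 + 0`
and `K(W) = K(x, y)` is finitely generated. This holds for every Weierstrass equation (no smoothness).
No Mathlib or Literature instance of this class for `W.FunctionField` exists, so nothing is
overridden. [folklore] -/
instance isAlgFunctionField : IsAlgFunctionField K W.FunctionField where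
  trdeg_eq_one := by
    haveI := isAlgebraic_polynomial W
    have h := trdeg_add_eq K K[X] (A := W.FunctionField)
    rwa [Polynomial.trdeg_of_isDomain, trdeg_eq_zero, add_zero, eq_comm] at h
  fg_top :=
    ⟨{algebraMap K[X] W.FunctionField X,
      algebraMap W.CoordinateRing W.FunctionField (WeierstrassCurve.Affine.CoordinateRing.mk W Y)},
      by rw [Finset.coe_insert, Finset.coe_singleton, adjoin_x_y_eq_top]⟩

/-- Every place of `K(W)/K` has a residue field of finite degree over `K` (Stichtenoth
Prop. 1.1.15, discharged in `FunctionFieldGenusProofs` for every algebraic function field of one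
variable; recorded here as an instance for `K(W)`). [cite: Stichtenoth2009, Prop. 1.1.15] -/
instance finiteDimensional_residueField (P : AlgFunctionField.PlaceOver K W.FunctionField) :
    FiniteDimensional K P.residueField :=
  AlgFunctionField.PlaceOver.finiteDimensional_residueField_holds P

/-! ### The place at infinity is the only pole of `x` -/

/-- **Places not containing `x` are the place at infinity.** If `x ∉ O_P` then `|x|_P > 1`, so
`O_∞ ⊆ O_P` (`map_le_one_of_infValuationF_le_one`) and hence `O_P = O_∞`, the DVR `O_∞` being a
maximal proper subring of `K(W)` (Silverman AEC Prop. III.3.1: `O = [0,1,0]` is the only point of `E`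
on the line at infinity; Stichtenoth Prop. 6.1.3: the pole of `x` has a unique place above it).
[cite: SilvermanAEC2009, Prop. III.3.1] -/
theorem eq_infPlace {P : AlgFunctionField.PlaceOver K W.FunctionField}
    (hx : algebraMap K[X] W.FunctionField X ∉ P.toValuationSubring) :
    P = WeierstrassPlaceAtInfinity.infPlace W := by
  set O := P.toValuationSubring with hO
  have hK : ∀ c : K, O.valuation (algebraMap K W.FunctionField c) ≤ 1 := fun c ↦
    (O.valuation_le_one_iff _).2 (P.algebraMap_mem c)
  have hx' : 1 < O.valuation (algebraMap K[X] W.FunctionField X) := by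
    rw [← not_le, O.valuation_le_one_iff]; exact hx
  refine AlgFunctionField.PlaceOver.ext (ValuationSubring.eq_of_le_of_ne_top _ ?_ P.ne_top).symm
  intro z hz
  rw [WeierstrassPlaceAtInfinity.mem_infPlace_iff] at hz
  exact (O.valuation_le_one_iff _).1 (map_le_one_of_infValuationF_le_one W O.valuation hK hx' hz)

/-! ### The finite places -/

section Places

open AlgFunctionField

variable [IsDedekindDomain W.CoordinateRing]

/- The **finite places** of `K(W)/K` are the places `PlaceOver.ofPrime K K(W) 𝔭` of
`FunctionFieldGenusRatPlacesProofs` attached to the maximal ideals `𝔭` of the Dedekind domain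
`K[W]` (valuation ring `{z : |z|_𝔭 ≤ 1} = K[W]_𝔭`; Silverman AEC Prop. II.1.1: the local ring
of a smooth point of a curve is a DVR). Their basic API (`PlaceOver.mem_ofPrime_iff`,
`PlaceOver.algebraMap_mem_ofPrime`, `PlaceOver.ofPrime_injective`) is in that file. -/

/-- `x ∈ O_𝔭` for every finite place (`x` is regular on the affine curve). [folklore] -/
theorem x_mem_ofPrime (v : HeightOneSpectrum W.CoordinateRing) :
    algebraMap K[X] W.FunctionField X ∈ (PlaceOver.ofPrime K W.FunctionField v).toValuationSubring := by
  rw [IsScalarTower.algebraMap_apply K[X] W.CoordinateRing W.FunctionField]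
  exact PlaceOver.algebraMap_mem_ofPrime v _

/-- The place at infinity is not a finite place (`x ∉ O_∞`, `x ∈ O_𝔭`). [folklore] -/
theorem infPlace_ne_ofPrime (v : HeightOneSpectrum W.CoordinateRing) :
    WeierstrassPlaceAtInfinity.infPlace W ≠ PlaceOver.ofPrime K W.FunctionField v := fun h ↦
  WeierstrassPlaceAtInfinity.x_not_mem_infPlace W (h ▸ x_mem_ofPrime W v)

/-- **Places containing `x` are finite.** If `x ∈ O_P` then `K[W] ⊆ O_P` (`map_coordinateRing_le_one`),
`𝔭 := K[W] ∩ 𝔪_P` is a nonzero prime (else `K(W) ⊆ O_P`), so `K[W]_𝔭 ⊆ O_P ⊊ K(W)` and, `K[W]_𝔭`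
being a DVR (a maximal proper subring), `O_P = K[W]_𝔭` (Mathlib
`ValuationSubring.eq_of_le_of_ne_top`). This is the affine half of the correspondence
"places of `K(C)` ↔ closed points of the smooth projective curve `C`" (Silverman AEC II.1–II.2,
Prop. II.1.1 and Ex. 2.1; Stichtenoth Thm. 1.1.6 ff. for `K(x)`). [cite: SilvermanAEC2009, Prop. II.1.1] -/
theorem exists_eq_ofPrime {P : PlaceOver K W.FunctionField}
    (hx : algebraMap K[X] W.FunctionField X ∈ P.toValuationSubring) :
    ∃ v : HeightOneSpectrum W.CoordinateRing, P = PlaceOver.ofPrime K W.FunctionField v := by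
  set O := P.toValuationSubring with hO
  have hK : ∀ c : K, O.valuation (algebraMap K W.FunctionField c) ≤ 1 := fun c ↦
    (O.valuation_le_one_iff _).2 (P.algebraMap_mem c)
  have hx' : O.valuation (algebraMap K[X] W.FunctionField X) ≤ 1 := (O.valuation_le_one_iff _).2 hx
  have hR : ∀ r : W.CoordinateRing, algebraMap W.CoordinateRing W.FunctionField r ∈ O := fun r ↦
    (O.valuation_le_one_iff _).1 (map_coordinateRing_le_one W O.valuation hK hx' r)
  -- the centre `𝔭 = K[W] ∩ 𝔪_P`
  let φ : W.CoordinateRing →+* O := (algebraMap W.CoordinateRing W.FunctionField).codRestrict O hR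
  let 𝔭 : Ideal W.CoordinateRing := Ideal.comap φ (IsLocalRing.maximalIdeal O)
  have hmem : ∀ r : W.CoordinateRing,
      r ∈ 𝔭 ↔ O.valuation (algebraMap W.CoordinateRing W.FunctionField r) < 1 := fun r ↦ by
    rw [Ideal.mem_comap, ValuationSubring.valuation_lt_one_iff]
    rfl
  haveI h𝔭 : 𝔭.IsPrime := Ideal.IsPrime.comap φ
  have hval1 : ∀ r : W.CoordinateRing, r ∉ 𝔭 →
      O.valuation (algebraMap W.CoordinateRing W.FunctionField r) = 1 := fun r hr ↦
    le_antisymm ((O.valuation_le_one_iff _).2 (hR r)) (not_lt.1 ((hmem r).not.1 hr))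
  have hne : 𝔭 ≠ ⊥ := by
    intro hbot
    apply P.ne_top
    rw [← hO, eq_top_iff]
    intro z _
    obtain ⟨r, s, hs, rfl⟩ := IsFractionRing.div_surjective (A := W.CoordinateRing) z
    have hs0 : s ≠ 0 := nonZeroDivisors.ne_zero hs
    have hs𝔭 : s ∉ 𝔭 := by rw [hbot]; exact hs0
    rw [← O.valuation_le_one_iff, map_div₀, hval1 s hs𝔭, div_one, O.valuation_le_one_iff]
    exact hR r
  let v : HeightOneSpectrum W.CoordinateRing := ⟨𝔭, h𝔭, hne⟩
  refine ⟨v, PlaceOver.ext (ValuationSubring.eq_of_le_of_ne_top _ ?_ P.ne_top).symm⟩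
  -- `K[W]_𝔭 ⊆ O_P`
  intro z hz
  change v.valuation W.FunctionField z ≤ 1 at hz
  obtain ⟨n, d, hzd⟩ := HeightOneSpectrum.exists_primeCompl_mul_eq_of_integer v z hz
  have hd : (d : W.CoordinateRing) ∉ 𝔭 := d.2
  have hd1 := hval1 d hd
  rw [← O.valuation_le_one_iff]
  have h := congrArg O.valuation hzd
  rw [map_mul, hd1, mul_one] at h
  rw [h, O.valuation_le_one_iff]
  exact hR n

/-- **Classification of the places of `K(W)/K`** for a Weierstrass curve with Dedekind (i.e. smooth)
affine coordinate ring: every place is either the place at infinity `P_∞` or the finite place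
`P_𝔭` of a unique maximal ideal `𝔭 ⊂ K[W]` — the places of `K(E)` are the closed points of the
projective curve `E` (Silverman AEC II.1–II.2 with Prop. II.1.1, Thm. II.2.4 and Prop. III.3.1; Stichtenoth
§6.1). [cite: SilvermanAEC2009, Prop. II.1.1 and Prop. III.3.1] -/
theorem eq_infPlace_or_exists_eq_ofPrime (P : PlaceOver K W.FunctionField) :
    P = WeierstrassPlaceAtInfinity.infPlace W ∨
      ∃ v : HeightOneSpectrum W.CoordinateRing, P = PlaceOver.ofPrime K W.FunctionField v := by
  by_cases hx : algebraMap K[X] W.FunctionField X ∈ P.toValuationSubring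
  · exact Or.inr (exists_eq_ofPrime W hx)
  · exact Or.inl (eq_infPlace W hx)

/-- The places of `K(W)/K` are in bijection with `{∞} ⊔ MaxSpec K[W]`. [cite: SilvermanAEC2009, Prop. II.1.1 and Prop. III.3.1] -/
def placeEquiv : Option (HeightOneSpectrum W.CoordinateRing) ≃ PlaceOver K W.FunctionField where
  toFun o := o.elim (WeierstrassPlaceAtInfinity.infPlace W) (PlaceOver.ofPrime K W.FunctionField)
  invFun P :=
    open Classical in
    if h : ∃ v : HeightOneSpectrum W.CoordinateRing, P = PlaceOver.ofPrime K W.FunctionField v then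
      some h.choose else none
  left_inv o := by
    classical
    cases o with
    | none =>
      simp only [Option.elim]
      rw [dif_neg]
      rintro ⟨v, hv⟩
      exact infPlace_ne_ofPrime W v hv
    | some v =>
      have h : ∃ v' : HeightOneSpectrum W.CoordinateRing,
          PlaceOver.ofPrime K W.FunctionField v = PlaceOver.ofPrime K W.FunctionField v' := ⟨v, rfl⟩
      simp only [Option.elim]
      rw [dif_pos h, Option.some.injEq]
      exact PlaceOver.ofPrime_injective h.choose_spec.symm
  right_inv P := by
    classical
    rcases eq_infPlace_or_exists_eq_ofPrime W P with rfl | h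
    · simp only
      rw [dif_neg]
      · rfl
      · rintro ⟨v, hv⟩
        exact infPlace_ne_ofPrime W v hv
    · simp only
      rw [dif_pos h]
      exact h.choose_spec.symm

/-- An element of `K(W)` lying in the valuation ring of every finite place lies in `K[W]`
(`K[W] = ⋂_𝔭 K[W]_𝔭` for the Dedekind domain `K[W]`; Mathlib
`HeightOneSpectrum.mem_integers_of_valuation_le_one`). [folklore] -/
theorem exists_eq_algebraMap_of_forall_mem_ofPrime {z : W.FunctionField}
    (h : ∀ v : HeightOneSpectrum W.CoordinateRing,
      z ∈ (PlaceOver.ofPrime K W.FunctionField v).toValuationSubring) :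
    ∃ r : W.CoordinateRing, algebraMap W.CoordinateRing W.FunctionField r = z :=
  HeightOneSpectrum.mem_integers_of_valuation_le_one W.FunctionField z h

/-- **`L(0) = K` for `K(W)`:** an element of `K(W)` lying in the valuation ring of every place is a
constant (it lies in `K[W]` by the finite places and then has no pole at `P_∞`; Silverman AEC
Prop. II.1.2: a function without poles is constant; Stichtenoth Cor. 1.1.20). [cite: SilvermanAEC2009, Prop. II.1.2] -/
theorem exists_eq_algebraMap_of_forall_mem {z : W.FunctionField}
    (h : ∀ P : PlaceOver K W.FunctionField, z ∈ P.toValuationSubring) :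
    ∃ c : K, algebraMap K W.FunctionField c = z := by
  obtain ⟨r, rfl⟩ := exists_eq_algebraMap_of_forall_mem_ofPrime W fun v ↦
    h (PlaceOver.ofPrime K W.FunctionField v)
  have hr := h (WeierstrassPlaceAtInfinity.infPlace W)
  rw [WeierstrassPlaceAtInfinity.mem_infPlace_iff, WeierstrassPlaceAtInfinity.infValuationF_algebraMap]
    at hr
  obtain ⟨c, rfl⟩ := WeierstrassPlaceAtInfinity.exists_eq_algebraMap_of_infValuation_le_one W hr
  exact ⟨c, by rw [IsScalarTower.algebraMap_apply K K[X] W.FunctionField,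
    IsScalarTower.algebraMap_apply K[X] W.CoordinateRing W.FunctionField]; rfl⟩

/-- **`K` is the full constant field of `K(W)`** (`K` is algebraically closed in `K(W)`): an element
of `K(W)` integral over `K` lies in every valuation ring of `K(W)/K` (valuation rings are integrally
closed), hence is a constant (Silverman AEC Prop. II.1.2; Stichtenoth Def. 6.1.1 and Prop. 6.1.3: an
elliptic function field has `K` as its full constant field by definition, and `K(x, y)` given by a
smooth Weierstrass equation is one). No Mathlib instance of this form exists. [cite: SilvermanAEC2009, Prop. II.1.2] -/
instance isIntegrallyClosedIn : IsIntegrallyClosedIn K W.FunctionField := by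
  refine isIntegrallyClosedIn_iff.2
    ⟨FaithfulSMul.algebraMap_injective K W.FunctionField, fun {z} hz ↦ ?_⟩
  refine exists_eq_algebraMap_of_forall_mem W fun P ↦ ?_
  have hint : IsIntegral P.toValuationSubring z := hz.tower_top
  have hInt : P.toValuationSubring.valuation.Integers P.toValuationSubring :=
    ⟨Subtype.val_injective, P.toValuationSubring.valuation_le_one,
      fun r hr ↦ ⟨⟨r, (P.toValuationSubring.valuation_le_one_iff r).1 hr⟩, rfl⟩⟩
  exact (P.toValuationSubring.valuation_le_one_iff z).1 (hInt.isIntegral_iff_v_le_one.1 hint)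

end Places

end Literature.NumberTheory.DiophantineGeometry.WeierstrassPlaces
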